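import Mathlib.Analysis.Calculus.BumpFunction.InnerProduct
import Mathlib.Analysis.InnerProductSpace.PiL2
import Mathlib.Analysis.Calculus.ContDiff.Basic

/-!
# Helper `helper_acsExtend` of line `Sketch` (pencil-incompleteness) for crux `WitnessCharge`
(item stmt-SmoothPoincare4-7824; route `SullivanDual`, crux
`Summit.SmoothPoincare4.SmoothPoincare4.Theses.SullivanDual.WitnessCharge`; line `Sketch`,
stub `helper_acsExtend` — frontier dichotomy (P5): extending a local almost complex structure
on `ℝ⁴` to a global one)

**Extending a local almost complex structure.** Let `Jloc : ℝ⁴ → End(ℝ⁴)` be smooth on an open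
set `V ∋ y₀` with `Jloc y ∘ Jloc y = -1` for `y ∈ V`. Then there is a globally smooth
`Jt : ℝ⁴ → End(ℝ⁴)` with `Jt y ∘ Jt y = -1` for EVERY `y`, agreeing with `Jloc` on an open
neighbourhood `W ⊆ V` of `y₀`.

Proof (smooth retraction onto a ball, no partition of unity). Choose `r > 0` with
`ball y₀ r ⊆ V` and a smooth bump `χ` (`ContDiffBump y₀` with `rIn = r / 2`, `rOut = r`;
`ℝ⁴ = EuclideanSpace ℝ (Fin 4)` is an inner product space, hence `HasContDiffBump`). The smooth
map `π y = y₀ + χ y • (y - y₀)` takes values in `ball y₀ r ⊆ V` (if `dist y y₀ < r` then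
`‖χ y • (y - y₀)‖ ≤ ‖y - y₀‖ < r`, otherwise `χ y = 0` and `π y = y₀`) and is the identity on
`W = ball y₀ (r / 2)` (where `χ = 1`). Put `Jt = Jloc ∘ π`: it is smooth
(`ContDiffOn.comp_contDiff`), `Jt y (Jt y v) = Jloc (π y) (Jloc (π y) v) = -v` as `π y ∈ V`,
and `Jt = Jloc` on `W`.
-/

noncomputable section

-- the registered namespace `Summit.SmoothPoincare4.SmoothPoincare4.…` repeats a component
set_option linter.dupNamespace false

open scoped ContDiff Topology
open Set Filter Metric

namespace Summit.SmoothPoincare4.SmoothPoincare4.Theorems.WitnessCharge.PencilIncompleteness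

/-- **Extending a local almost complex structure on `ℝ⁴`.** If `Jloc` is smooth on an open set
`V ∋ y₀` of `ℝ⁴ = EuclideanSpace ℝ (Fin 4)` with `Jloc y (Jloc y v) = -v` there, then some
globally smooth `Jt` with `Jt y (Jt y v) = -v` everywhere agrees with `Jloc` on an open
neighbourhood `W ⊆ V` of `y₀` (namely `Jt = Jloc ∘ π` for a smooth retraction `π` of `ℝ⁴` into a
ball around `y₀` inside `V`, built from a smooth bump function). -/
theorem helper_acsExtend :
    ∀ (Jloc : EuclideanSpace ℝ (Fin 4) → EuclideanSpace ℝ (Fin 4) →L[ℝ] EuclideanSpace ℝ (Fin 4))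
      (V : Set (EuclideanSpace ℝ (Fin 4))) (y₀ : EuclideanSpace ℝ (Fin 4)),
      IsOpen V → y₀ ∈ V → ContDiffOn ℝ ∞ Jloc V → (∀ y ∈ V, ∀ v, Jloc y (Jloc y v) = -v) →
      ∃ (Jt : EuclideanSpace ℝ (Fin 4) → EuclideanSpace ℝ (Fin 4) →L[ℝ] EuclideanSpace ℝ (Fin 4))
        (W : Set (EuclideanSpace ℝ (Fin 4))),
        ContDiff ℝ ∞ Jt ∧ (∀ y v, Jt y (Jt y v) = -v) ∧ IsOpen W ∧ y₀ ∈ W ∧ W ⊆ V ∧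
        ∀ y ∈ W, Jt y = Jloc y := by
  intro Jloc V y₀ hV hy₀ hJloc hJ2
  -- a ball around `y₀` inside `V`
  obtain ⟨r, hr, hrV⟩ := Metric.isOpen_iff.1 hV y₀ hy₀
  -- a smooth bump: `1` on `closedBall y₀ (r / 2)`, supported in `ball y₀ r`, values in `[0, 1]`
  let χ : ContDiffBump y₀ := ⟨r / 2, r, half_pos hr, half_lt_self hr⟩
  -- the smooth retraction of `ℝ⁴` into `ball y₀ r`
  let π : EuclideanSpace ℝ (Fin 4) → EuclideanSpace ℝ (Fin 4) := fun y => y₀ + χ y • (y - y₀)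
  have hπ_smooth : ContDiff ℝ ∞ π :=
    contDiff_const.add (χ.contDiff.smul (contDiff_id.sub contDiff_const))
  have hπ_ball : ∀ y, π y ∈ ball y₀ r := by
    intro y
    rw [mem_ball, dist_eq_norm]
    have hπy : π y - y₀ = χ y • (y - y₀) := by simp [π]
    rw [hπy, norm_smul, Real.norm_of_nonneg χ.nonneg]
    by_cases hy : dist y y₀ < r
    · calc χ y * ‖y - y₀‖ ≤ 1 * ‖y - y₀‖ := by gcongr; exact χ.le_one
        _ = dist y y₀ := by rw [one_mul, dist_eq_norm]
        _ < r := hy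
    · have hχ0 : χ y = 0 := χ.zero_of_le_dist (not_lt.1 hy)
      rw [hχ0, zero_mul]
      exact hr
  have hπ_V : ∀ y, π y ∈ V := fun y => hrV (hπ_ball y)
  have hπ_W : ∀ y ∈ ball y₀ (r / 2), π y = y := by
    intro y hy
    have hχ1 : χ y = 1 := χ.one_of_mem_closedBall (ball_subset_closedBall hy)
    simp [π, hχ1]
  refine ⟨fun y => Jloc (π y), ball y₀ (r / 2), hJloc.comp_contDiff hπ_smooth hπ_V,
    fun y v => hJ2 (π y) (hπ_V y) v, isOpen_ball, mem_ball_self (half_pos hr),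
    (ball_subset_ball (half_le_self hr.le)).trans hrV, fun y hy => ?_⟩
  show Jloc (π y) = Jloc y
  rw [hπ_W y hy]

end Summit.SmoothPoincare4.SmoothPoincare4.Theorems.WitnessCharge.PencilIncompleteness
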